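import Summits.Schanuel.Schanuel.Theses.DiophantineDichotomy
import HarnessLib

/-!
# The DIAGONAL cofinal form of crux `ApproximationProperty` drives the route iff crux 2 is all-heights with `b < 1 + 1/(n−1)` (stmt-Schanuel-6117, planning glue)

Route `DiophantineDichotomy` (sub-problem `Schanuel/Schanuel`), crux stmt-Schanuel-6117
`Summit.Schanuel.Schanuel.Theses.DiophantineDichotomy.ApproximationProperty`. KERNEL-c11.md §6 (line lead
`prover-line-stmt-Schanuel-6117-c11-0`): the only form of Philippon's approximation property that is "in print" for EVERY
transcendence degree `t` is the DIAGONAL COFINAL one (Massold, arXiv:0711.3645 Thm 1.2 / Cor 1.3, unpublished: for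
cofinally many `Δ` a datum at the diagonal scale `Y = Δ`, degree `≤ (cΔ)^t`, log-height `≤ cΔ^t`, precision
`≥ (Δ·log H + d·Δ)/c`). The route's deciding theorem `closes` cannot consume it with crux 2 AS FILED
(`KhovanskiiApproxTypeEv`: exponent `b` free, threshold `H₀(d)` arbitrary — both are paid for by letting `Y → ∞` at a FIXED
degree cap, i.e. by the race form, which is open for `t ≥ 3`). This file kernel-checks the exact trade: the diagonal form
DOES drive the race provided the measure at free Khovanskii points holds at ALL heights with the coupled exponent
`b < 1 + 1/(n−1)` (then `d·Δ ≫ dᵇ` on the diagonal because `d ≤ (cΔ)^{n−1}`). One registered sub-goal, PROOF ONLY, both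
hypotheses written out inline (no definition is introduced; nothing open is asserted):

* `khovanskiiSchanuel_of_apDiag_of_coupledMeasure` — (diagonal cofinal AP, all `t`) → (all-heights measure with
  `a < 1/(n−1)`, `b < 1 + 1/(n−1)`) → `KhovanskiiSchanuel`.

Sources: the route file (`closes`); `…ApproximationPropertyRace.lean` (c10); Massold arXiv:0711.3645; Waldschmidt GL326
Conj. 15.31; NesterenkoPhilippon2001 Ch. 4 §4.
-/

noncomputable section

-- `Summit.Schanuel.Schanuel.…` is the mandated summit/sub-problem namespace (single-conjunct summit), hence:
set_option linter.dupNamespace false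

namespace Summit.Schanuel.Schanuel.Cruxes.ApproximationProperty.Race

open Summit.Schanuel.Schanuel.Theses.DiophantineDichotomy

/-- **Registered sub-goal `khovanskiiSchanuel_of_apDiag_of_coupledMeasure`** — the DIAGONAL COFINAL approximation property
(for `θ ∈ ℂ^ι` with `trdeg_ℚ ℚ(θ) ≤ t`, `t ≥ 1`: a constant `c ≥ 1` and COFINALLY many scales `Δ ≥ c` carrying a datum
`(γ, d, H)` at the diagonal `Y = Δ`: `[ℚ(γ):ℚ] ≤ d ≤ (cΔ)^t`, certificates of degree `≤ d` and height `≤ H`,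
`log H ≤ cΔ^t`, `‖γ − θ‖ ≤ exp(−(log H·Δ + d·Δ)/c)` — Massold's Thm 1.2 in the crux's currency) together with the
ALL-HEIGHTS simultaneous-approximation measure at free Khovanskii points with COUPLED exponents
(`a < 1/(n−1)`, `b < 1 + 1/(n−1)`: `‖γ − (s,e^s)‖ ≥ exp(−C(dᵃ log H + dᵇ))` for every certified `γ` of joint degree `≤ d`)
imply Schanuel at free Khovanskii points (`KhovanskiiSchanuel`). Proof: `n ≤ 1` Hermite–Lindemann; `n ≥ 2`: if
`trdeg ℚ(s, e^s) ≤ t = n − 1`, take a diagonal datum at a scale `Δ` with `Δ^{1−tA} ≥ 2cC·c^{tA}` and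
`Δ^{1−tB} ≥ 2cC·c^{tB}` (`A = max a 0 < 1/t`, `B = max (b−1) 0 < 1/t`); then `Δ·log H/c ≥ 2C dᵃ log H` and
`d·Δ/c ≥ 2C dᵇ` (as `dᵇ ≤ d·d^B ≤ d(cΔ)^{tB}`), so the datum's precision `(Δ log H + dΔ)/c` is at least twice the
measure's `C(dᵃ log H + dᵇ) > 0` — contradiction. No height threshold is needed because the measure is all-heights; no
`Y → ∞` because `b` is coupled. [folklore] -/
theorem khovanskiiSchanuel_of_apDiag_of_coupledMeasure :
    (∀ (ι : Type) [Fintype ι] (θ : ι → ℂ) (t : ℕ), 1 ≤ t →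
      Algebra.trdeg ℚ ↥(IntermediateField.adjoin ℚ (Set.range θ)) ≤ (t : Cardinal) →
      ∃ c : ℝ, 1 ≤ c ∧ ∀ Δ₀ : ℝ, ∃ Δ : ℝ, Δ₀ ≤ Δ ∧ c ≤ Δ ∧
        ∃ (γ : ι → ℂ) (d H : ℕ),
          Module.finrank ℚ ↥(IntermediateField.adjoin ℚ (Set.range γ)) ≤ d ∧
          (∀ i, ∃ P : Polynomial ℤ, P ≠ 0 ∧ P.natDegree ≤ d ∧ (∀ k, |P.coeff k| ≤ (H : ℤ)) ∧
            Polynomial.aeval (γ i) P = 0) ∧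
          (d : ℝ) ≤ (c * Δ) ^ t ∧ Real.log H ≤ c * Δ ^ t ∧
          ‖γ - θ‖ ≤ Real.exp (-((Real.log H * Δ + d * Δ) / c))) →
    (∀ (n : ℕ) (s : Fin n → ℂ), 2 ≤ n → LinearIndependent ℚ s →
      (∃ g : Fin n → MvPolynomial (Fin n ⊕ Fin n) ℚ,
        (∀ i, MvPolynomial.aeval (Sum.elim s (Complex.exp ∘ s)) (g i) = 0) ∧
        (Matrix.of fun i j => MvPolynomial.aeval (Sum.elim s (Complex.exp ∘ s))
          (MvPolynomial.pderiv (Sum.inl j) (g i) +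
            MvPolynomial.X (Sum.inr j) * MvPolynomial.pderiv (Sum.inr j) (g i))).det ≠ 0) →
      ∃ a b C : ℝ, a < 1 / ((n : ℝ) - 1) ∧ b < 1 + 1 / ((n : ℝ) - 1) ∧ 0 < C ∧
        ∀ (d H : ℕ) (γ : Fin n ⊕ Fin n → ℂ),
          Module.finrank ℚ ↥(IntermediateField.adjoin ℚ (Set.range γ)) ≤ d →
          (∀ i, ∃ P : Polynomial ℤ, P ≠ 0 ∧ P.natDegree ≤ d ∧ (∀ k, |P.coeff k| ≤ (H : ℤ)) ∧
            Polynomial.aeval (γ i) P = 0) →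
          Real.exp (-(C * ((d : ℝ) ^ a * Real.log H + (d : ℝ) ^ b))) ≤
            ‖γ - Sum.elim s (Complex.exp ∘ s)‖) →
    KhovanskiiSchanuel := by
  intro hAP hM n s hs hg
  have HL := @Literature.NumberTheory.Transcendental.transcendental_exp_holds
  have one_le_of_transc : ∀ {L : IntermediateField ℚ ℂ} {w : ℂ}, w ∈ L → Transcendental ℚ w →
      (1 : Cardinal) ≤ Algebra.trdeg ℚ L := by
    intro L w hw ht
    haveI : Algebra.Transcendental ℚ L :=
      ⟨⟨⟨w, hw⟩, fun h => ht (IntermediateField.isAlgebraic_iff.mp h)⟩⟩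
    exact Cardinal.one_le_iff_pos.mpr (_root_.trdeg_pos ℚ L)
  have one_le_of_root : ∀ {P : Polynomial ℤ} {d : ℕ} {z : ℂ}, P ≠ 0 → P.natDegree ≤ d →
      Polynomial.aeval z P = 0 → 1 ≤ d := by
    intro P d z hP hdeg hz
    by_contra hd
    have hd0 : P.natDegree = 0 := by omega
    rw [Polynomial.eq_C_of_natDegree_eq_zero hd0, Polynomial.aeval_C, eq_intCast,
      Int.cast_eq_zero] at hz
    apply hP
    rw [Polynomial.eq_C_of_natDegree_eq_zero hd0, hz, map_zero]
  have one_le_H : ∀ {P : Polynomial ℤ} {H : ℕ}, P ≠ 0 → (∀ k, |P.coeff k| ≤ (H : ℤ)) → 1 ≤ H := by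
    intro P H hP hco
    obtain ⟨k, hk⟩ : ∃ k, P.coeff k ≠ 0 := by
      by_contra h
      push Not at h
      exact hP (Polynomial.ext fun k => by rw [h k, Polynomial.coeff_zero])
    have h1 : (1 : ℤ) ≤ |P.coeff k| := Int.one_le_abs hk
    have h2 : (1 : ℤ) ≤ (H : ℤ) := h1.trans (hco k)
    exact_mod_cast h2
  rcases Nat.lt_or_ge n 2 with hn | hn
  · interval_cases n
    · simp
    · -- `n = 1`: Hermite–Lindemann
      rw [Nat.cast_one]
      by_cases halg : IsAlgebraic ℚ (s 0)
      · exact one_le_of_transc (IntermediateField.subset_adjoin ℚ _ (Or.inr ⟨0, rfl⟩))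
          (HL halg (hs.ne_zero 0))
      · exact one_le_of_transc (IntermediateField.subset_adjoin ℚ _ (Or.inl ⟨0, rfl⟩)) halg
  · -- `n ≥ 2`: the DIAGONAL race (one cofinal scale `Δ`, `Y = Δ`; no height threshold, no `Y → ∞`)
    by_contra hlt
    rw [not_le] at hlt
    have key : ∀ S : Set ℂ, S = Set.range s ∪ Set.range (Complex.exp ∘ s) →
        Algebra.trdeg ℚ ↥(IntermediateField.adjoin ℚ S) ≤ ((n - 1 : ℕ) : Cardinal) := by
      rintro S rfl
      have h1 : (n : Cardinal) = Order.succ ((n - 1 : ℕ) : Cardinal) := by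
        rw [Cardinal.succ_natCast]
        exact_mod_cast (by omega : n = n - 1 + 1)
      rw [h1] at hlt
      exact Order.lt_succ_iff.mp hlt
    obtain ⟨c, hc1, hAP'⟩ := hAP (Fin n ⊕ Fin n) (Sum.elim s (Complex.exp ∘ s)) (n - 1)
      (by omega) (key _ (Set.Sum.elim_range _ _))
    obtain ⟨a, b, C, ha, hb, hC, hM'⟩ := hM n s hn hs hg
    have hcpos : (0 : ℝ) < c := lt_of_lt_of_le one_pos hc1
    -- the two eventual conditions on the scale `Δ`
    set t : ℕ := n - 1 with htdef
    have ht1 : 1 ≤ t := by omega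
    have htpos : (0 : ℝ) < t := by exact_mod_cast ht1
    have htinv : 1 / ((n : ℝ) - 1) = 1 / (t : ℝ) := by
      rw [htdef, Nat.cast_sub (by omega), Nat.cast_one]
    rw [htinv] at ha hb
    set A : ℝ := max a 0 with hAdef
    set B : ℝ := max (b - 1) 0 with hBdef
    have hA0 : 0 ≤ A := le_max_right _ _
    have hB0 : 0 ≤ B := le_max_right _ _
    have hAt : (t : ℝ) * A < 1 := by
      have hA' : A < 1 / (t : ℝ) := max_lt ha (by positivity)
      calc (t : ℝ) * A < t * (1 / t) := mul_lt_mul_of_pos_left hA' htpos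
        _ = 1 := mul_one_div_cancel htpos.ne'
    have hBt : (t : ℝ) * B < 1 := by
      have hB' : B < 1 / (t : ℝ) := max_lt (by linarith) (by positivity)
      calc (t : ℝ) * B < t * (1 / t) := mul_lt_mul_of_pos_left hB' htpos
        _ = 1 := mul_one_div_cancel htpos.ne'
    have hcC : 0 ≤ c * C := by positivity
    have thr : ∀ E : ℝ, 0 ≤ E → (t : ℝ) * E < 1 → ∀ᶠ Δ : ℝ in Filter.atTop,
        2 * (c * C) * c ^ ((t : ℝ) * E) * Δ ^ ((t : ℝ) * E) ≤ Δ := by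
      intro E hE hEt
      set e : ℝ := 1 - t * E with he
      have hepos : 0 < e := by rw [he]; linarith
      set M : ℝ := 2 * (c * C) * c ^ ((t : ℝ) * E) with hM
      filter_upwards [(tendsto_rpow_atTop hepos).eventually_ge_atTop M,
        Filter.eventually_gt_atTop (0 : ℝ)] with Δ hMΔ hΔpos
      calc M * Δ ^ ((t : ℝ) * E) ≤ Δ ^ e * Δ ^ ((t : ℝ) * E) :=
            mul_le_mul_of_nonneg_right hMΔ (Real.rpow_nonneg hΔpos.le _)
        _ = Δ := by rw [← Real.rpow_add hΔpos, he, sub_add_cancel, Real.rpow_one]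
    obtain ⟨Δ₀, hΔ₀⟩ := Filter.eventually_atTop.mp ((thr A hA0 hAt).and (thr B hB0 hBt))
    -- the diagonal datum at a cofinal scale `Δ ≥ Δ₀`, `Δ ≥ c`
    obtain ⟨Δ, hΔ₀Δ, hcΔ, γ, d, H, hfin, hpoly, hdcap, -, hdist⟩ := hAP' Δ₀
    obtain ⟨hIA, hIB⟩ := hΔ₀ Δ hΔ₀Δ
    have hΔpos : 0 < Δ := lt_of_lt_of_le hcpos hcΔ
    have hcΔpos : 0 < c * Δ := mul_pos hcpos hΔpos
    obtain ⟨P₀, hP₀0, hP₀deg, hP₀H, hP₀z⟩ := hpoly (Sum.inl ⟨0, by omega⟩)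
    have h1d : 1 ≤ d := one_le_of_root hP₀0 hP₀deg hP₀z
    have h1H : 1 ≤ H := one_le_H hP₀0 hP₀H
    have hd1 : (1 : ℝ) ≤ d := by exact_mod_cast h1d
    have hd0 : (0 : ℝ) ≤ d := by positivity
    have hL : 0 ≤ Real.log H := Real.log_nonneg (by exact_mod_cast h1H)
    -- the all-heights measure at `γ`
    have hlow := hM' d H γ hfin hpoly
    have hsand := neg_le_neg (Real.exp_le_exp.mp (hlow.trans hdist))
    rw [neg_neg, neg_neg, div_le_iff₀ hcpos] at hsand
    -- `hsand : Real.log H * Δ + d * Δ ≤ C * (d ^ a * Real.log H + d ^ b) * c`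
    have hpow : ∀ E : ℝ, 0 ≤ E → (d : ℝ) ^ E ≤ (c * Δ) ^ ((t : ℝ) * E) := fun E hE => by
      calc (d : ℝ) ^ E ≤ ((c * Δ) ^ t) ^ E := Real.rpow_le_rpow hd0 hdcap hE
        _ = (c * Δ) ^ ((t : ℝ) * E) := by
          rw [← Real.rpow_natCast, ← Real.rpow_mul hcΔpos.le]
    -- (I) `2cC dᵃ log H ≤ Δ log H`
    have hda : (d : ℝ) ^ a ≤ (d : ℝ) ^ A := Real.rpow_le_rpow_of_exponent_le hd1 (le_max_left _ _)
    have hI : 2 * (c * C) * (d : ℝ) ^ A ≤ Δ := by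
      calc 2 * (c * C) * (d : ℝ) ^ A ≤ 2 * (c * C) * (c * Δ) ^ ((t : ℝ) * A) :=
            mul_le_mul_of_nonneg_left (hpow A hA0) (by positivity)
        _ = 2 * (c * C) * c ^ ((t : ℝ) * A) * Δ ^ ((t : ℝ) * A) := by
            rw [Real.mul_rpow hcpos.le hΔpos.le]; ring
        _ ≤ Δ := hIA
    have hI' : 2 * (c * C) * ((d : ℝ) ^ a * Real.log H) ≤ Δ * Real.log H := by
      calc 2 * (c * C) * ((d : ℝ) ^ a * Real.log H)
          ≤ 2 * (c * C) * ((d : ℝ) ^ A * Real.log H) :=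
            mul_le_mul_of_nonneg_left (mul_le_mul_of_nonneg_right hda hL) (by positivity)
        _ = (2 * (c * C) * (d : ℝ) ^ A) * Real.log H := by ring
        _ ≤ Δ * Real.log H := mul_le_mul_of_nonneg_right hI hL
    -- (II) `2cC dᵇ ≤ d Δ`, using `dᵇ ≤ d · d^B ≤ d (cΔ)^{tB}`
    have hdb : (d : ℝ) ^ b ≤ (d : ℝ) * (d : ℝ) ^ B := by
      have hb1 : b ≤ 1 + B := by
        have := le_max_left (b - 1) 0
        linarith
      calc (d : ℝ) ^ b ≤ (d : ℝ) ^ (1 + B) := Real.rpow_le_rpow_of_exponent_le hd1 hb1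
        _ = (d : ℝ) * (d : ℝ) ^ B := by
          rw [Real.rpow_add (by positivity), Real.rpow_one]
    have hII : 2 * (c * C) * (d : ℝ) ^ b ≤ (d : ℝ) * Δ := by
      calc 2 * (c * C) * (d : ℝ) ^ b ≤ 2 * (c * C) * ((d : ℝ) * (d : ℝ) ^ B) :=
            mul_le_mul_of_nonneg_left hdb (by positivity)
        _ ≤ 2 * (c * C) * ((d : ℝ) * (c * Δ) ^ ((t : ℝ) * B)) :=
            mul_le_mul_of_nonneg_left (mul_le_mul_of_nonneg_left (hpow B hB0) hd0) (by positivity)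
        _ = (d : ℝ) * (2 * (c * C) * c ^ ((t : ℝ) * B) * Δ ^ ((t : ℝ) * B)) := by
            rw [Real.mul_rpow hcpos.le hΔpos.le]; ring
        _ ≤ (d : ℝ) * Δ := mul_le_mul_of_nonneg_left hIB hd0
    -- the strict positivity of the measure's exponent
    have hpos : 0 < C * ((d : ℝ) ^ a * Real.log H + (d : ℝ) ^ b) := by
      have h1 : 0 ≤ (d : ℝ) ^ a * Real.log H := mul_nonneg (Real.rpow_nonneg hd0 _) hL
      have h2 : 0 < (d : ℝ) ^ b := Real.rpow_pos_of_pos (by positivity) _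
      exact mul_pos hC (by linarith)
    have hexp : 2 * (c * C) * ((d : ℝ) ^ a * Real.log H) + 2 * (c * C) * (d : ℝ) ^ b =
        2 * (C * ((d : ℝ) ^ a * Real.log H + (d : ℝ) ^ b) * c) := by ring
    nlinarith [hI', hII, hsand, hpos, hexp, hcpos]

end Summit.Schanuel.Schanuel.Cruxes.ApproximationProperty.Race

end
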